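import Literature.Geometry.Kaehler.ComplexTorusAbelianSurfaceComplexMultiplicationHodgeEqLefschetz
import Literature.Geometry.Kaehler.ComplexTorusAbelianSurfaceNonSimpleStablyNondegenerate
import HarnessLib

/-!
# Moonen–Zarhin 1999, §3 at `g = 2`: EVERY complex abelian SURFACE is STABLY NONDEGENERATE — `ℬ•(Xⁿ) = 𝒟•(Xⁿ)` for
# every `n` (all Hodge classes on all powers are generated by divisor classes, hence algebraic), `Hg(X) = Sp_D(V,φ)`
# (`= S(X) = Lf(X)`, Milne's centraliser, which is connected), for every polarisation

Layer `Literature/Geometry/Kaehler`, namespace `Literature.Geometry.Kaehler.ComplexTorus`; lane `lit-hodgefound`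
(Track 2 foundations library), Layer A4; prover seat `lit-hodgefound-p17` (generation 49), self-proposed row g49-#2 —
the ASSEMBLY of Moonen–Zarhin's list (2.2) for `g = 2`, each entry of which is a theorem of the tree at torus level:
Type I(1) (`End⁰(X) = ℚ`) and Type I(2) (real quadratic field) — p17 g47-#1∕#2∕#10 and g48-#2
(`ComplexTorusAbelianSurfaceFirstKindHodgeEqLefschetz`: `IsSimple.hodgeGroup_eq_lefschetzIdentity_of_not_isAlbertTypeIV_of_finrank_eq_two`);
Type II(1) (indefinite quaternion algebra) — g48-#1; Type IV(2,1) (quartic CM field) — g49-#1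
(`ComplexTorusAbelianSurfaceComplexMultiplicationHodgeEqLefschetz`: `IsSimple.hodgeGroup_eq_lefschetzIdentity_of_isAlbertTypeIV_of_finrank_eq_two`);
non-simple surfaces (`X ∼ E_{τ₁} × E_{τ₂}`) — g48-#3 (`ComplexTorusAbelianSurfaceNonSimpleStablyNondegenerate`:
`IsRiemannForm.forall_divisorClasses_powPeriod_eq_hodgeClasses_of_not_isSimple_of_finrank_eq_two`); type III never occurs
for a surface (Shimura).  The converse direction of Gordon's Thm. 7.5 ∕ Milne's Prop. 4.8
(`IsRiemannForm.forall_divisorClasses_powPeriod_eq_hodgeClasses_iff_eq_and_hodgeGroup_eq_lefschetzGroup`) then yields, for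
EVERY polarised abelian surface, that Milne's `S(X)(ℂ)` is connected and `Hg(X) = Lf(X) = S(X) = Sp_D(V,φ)` on real and on
complex points.

THEOREMS ONLY (no definition, no instance, no notation, no named fact; D-0026, net debt 0); nothing restated — every
statement below is a two-to-four-line assembly BY NAME of the rows cited above.  The unprimed names
`IsRiemannForm.hodgeGroup_eq_lefschetzIdentity_of_finrank_eq_two` ∕ `IsRiemannForm.hodgeGroupC_eq_lefschetzIdentityC_of_finrank_eq_two`
∕ `IsRiemannForm.forall_divisorClasses_powPeriod_eq_hodgeClasses_of_finrank_eq_two` belong to g47-#10's Type I(2) statements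
(extra hypotheses `f : K →ₐ[ℚ] M_ι(ℚ)`, `f.range = End⁰(X)`); the hypothesis-free statements here carry a prime.

## Sources, VERBATIM (held copies; `p0NNN Lnn` = chunk file and line of the materialised text)

* B. Moonen, Yu. G. Zarhin, *Hodge classes on abelian varieties of low dimension*, Math. Ann. 315 (1999), held
  `paper:arxiv-math_9901113`: Introduction (p0001 L62–L64) «If `dim(X) ≤ 3` then every Hodge class on `X` is a linear
  combination of products of divisor classes»; §1 (p0001 L99–L100) «Write `D = End⁰(X)` and let `Sp_D(V,φ)` denote the
  centralizer of `D` inside the symplectic group `Sp(V,φ)`»; §1 (D) (p0004 L61–L66) «`ℬ•(Xⁿ) = 𝒟•(Xⁿ)` for all `n`. If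
  this condition is satisfied then the Hodge conjecture is "trivially" true for all `Xⁿ`»; §1 (p0004 L74–L87, Hazama ∕
  Murty) «`Hg(X) = Sp_D(V,φ)` ⟺ (`X` has no factors of type III and `𝒟•(Xⁿ) = ℬ•(Xⁿ)` for all `n`)»; §2 (p0005 L20–L22)
  «For `g := dim(X) ≤ 3` and `g = 5` we always find that `Hg(X) = Sp_D(V,φ)`. Since type III does not occur for `g ≤ 3`
  and `g = 5` (`X` simple!), it follows that `ℬ•(Xⁿ) = 𝒟•(Xⁿ)` for all `n`»; (2.2) `g = 2` (p0005 L53–L78) «There are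
  four cases. Type I(1) […] Type I(2) […] Type II(1) […] Type IV(2,1)»; §3 (p0008 L107–L111) «Combining this with
  Corollary (…), we have proven (…) in case `dim(X) ≤ 3`. In particular, for every complex abelian variety `X` of
  dimension `≤ 3` we have `Hg(X) = Sp_D(V,φ)` and condition (D) in (…) is satisfied».
* J. S. Milne, *Lefschetz classes on abelian varieties*, Duke Math. J. 96 (1999), held
  `paper:doi-10-1215-s0012-7094-99-09620-5`: §1 p. 644 (p0006 L16–L20) «`S(A)` is the largest algebraic subgroup of
  `Sp(e_D)` whose elements commute with the endomorphisms of `A`»; §2 Summary table p. 652 (p0014: «I ∣ Sp ∣ Yes ∣ Yes;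
  II ∣ Sp ∣ Yes ∣ Yes; III ∣ O ∣ Yes ∣ No; IV ∣ GL ∣ No ∣ Yes»); §4 Prop. 4.8 and Remark 4.9 (p0022 L72: «When `A` has an
  isogeny factor of type III, the conditions in Proposition 4.8 always fail»).
* B. B. Gordon, *A survey of the Hodge conjecture for abelian varieties* (1999), Thm. 7.5 («(1) `Hdg(Aᵏ) = Div(Aᵏ)` for all
  `k ≥ 1` ⟺ (2) `A` has no factor of type (III), and `Hg(A) = Lf(A)`»), through the tree.
* H. Lange, *Abelian Varieties over the Complex Numbers* (2023), held text: §7.2.4 Exercise (4) (p0334 L14–L21: `Lf(X)`,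
  «(b) `Lf(X)` is an algebraic group defined over `ℚ` containing `Hg(X)`»), §5.1.5 Exercise (2) (endomorphism algebras of
  abelian surfaces).
* K. Hulek, R. Laface, *On the Picard numbers of abelian varieties* (2019), §5.1 Prop. 5.1 (Shimura: no type III, no
  imaginary quadratic `End⁰` for a simple surface), through the tree.

## Contents

* §1 EVERY SIMPLE ABELIAN SURFACE: **`IsSimple.hodgeGroup_eq_lefschetzIdentity_of_finrank_eq_two`** (`Hg(X)(ℝ) = Lf(X)(ℝ)`,
  by the two cases type IV ∕ not type IV), `IsSimple.hodgeGroupC_eq_lefschetzIdentityC_of_finrank_eq_two`,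
  **`IsSimple.forall_divisorClasses_powPeriod_eq_hodgeClasses_of_finrank_eq_two`** (stably nondegenerate),
  `IsSimple.lefschetzIdentityC_eq_lefschetzGroupC_of_finrank_eq_two` (`S(X)(ℂ)` connected), `IsSimple.hodgeGroupC_eq_lefschetzGroupC_of_finrank_eq_two`,
  `IsSimple.hodgeGroup_eq_lefschetzGroup_of_finrank_eq_two` (`Hg = S = Sp_D(V,φ)`).
* §2 EVERY POLARISED ABELIAN SURFACE: **`IsRiemannForm.divisorClasses_powPeriod_eq_hodgeClasses_of_finrank_eq_two`**
  (`ℬᵖ(Xᵏ) = 𝒟ᵖ(Xᵏ)` for all `k, p`), **`IsAbelianVariety.forall_divisorClasses_powPeriod_eq_hodgeClasses_of_finrank_eq_two`**,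
  **`IsRiemannForm.lefschetzIdentityC_eq_lefschetzGroupC_of_finrank_eq_two`** (`S(X)(ℂ)` is connected),
  **`IsRiemannForm.hodgeGroupC_eq_lefschetzGroupC_of_finrank_eq_two`** (`Hg(X)(ℂ) = S(X)(ℂ) = Sp_D(V,φ)(ℂ)`),
  `IsRiemannForm.hodgeGroupC_eq_lefschetzIdentityC_of_finrank_eq_two'`, **`IsRiemannForm.hodgeGroup_eq_lefschetzGroup_of_finrank_eq_two`**
  (`Hg(X)(ℝ) = S(X)(ℝ) = lefschetzGroup Ψ η`), `IsRiemannForm.hodgeGroup_eq_lefschetzIdentity_of_finrank_eq_two'`,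
  `IsRiemannForm.lefschetzIdentity_eq_lefschetzGroup_of_finrank_eq_two`.
-/

noncomputable section

open scoped Matrix
open Module Matrix NormedSpace NumberField
open Literature.RingTheory.CentralSimple (IsAlbertTypeIV)

namespace Literature.Geometry.Kaehler

namespace ComplexTorus

/-! ## §1 Every simple abelian surface: `Hg(X) = Lf(X) = S(X)`, stably nondegenerate -/

section Simple

variable {κ : Type} [Fintype κ] [DecidableEq κ] [Nonempty κ] {E : Type} [NormedAddCommGroup E] [NormedSpace ℂ E]
  [FiniteDimensional ℂ E] {Ψ : (κ → ℝ) ≃L[ℝ] E} {η : E [⋀^Fin 2]→L[ℝ] ℝ} {G : Matrix κ κ ℚ}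

/-- **`Hg(X)(ℝ) = Lf(X)(ℝ)` FOR EVERY SIMPLE POLARISED COMPLEX ABELIAN SURFACE** («For `g := dim(X) ≤ 3` […] we always find
that `Hg(X) = Sp_D(V,φ)`»; the four cases of (2.2): types I(1), I(2), II(1) by g48-#2, type IV(2,1) by g49-#1).
[cite: MoonenZarhin1999LowDim, §2 (p0005 L20–L22) and (2.2) `g = 2` (p0005 L53–L78), §3 (p0008 L107–L111)]
[cite: Lange2023AbelianVarietiesComplex, §7.2.4 Exercise (4)(b)] -/
theorem IsSimple.hodgeGroup_eq_lefschetzIdentity_of_finrank_eq_two (hX : IsSimple Ψ) (hη : IsRiemannForm Ψ η)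
    (hG : G.map (Rat.cast : ℚ → ℝ) = latticeGram Ψ η) (h2 : finrank ℂ E = 2) :
    hodgeGroup Ψ = lefschetzIdentity Ψ G := by
  by_cases hIV : IsAlbertTypeIV (centerField Ψ hX) (endAlgRat Ψ) (rosatiEnd Ψ hη.1 hη.2.2 hG)
  · exact hX.hodgeGroup_eq_lefschetzIdentity_of_isAlbertTypeIV_of_finrank_eq_two hη hG hIV h2
  · exact hX.hodgeGroup_eq_lefschetzIdentity_of_not_isAlbertTypeIV_of_finrank_eq_two hη hG hIV h2

/-- **`Hg(X)(ℂ) = Lf(X)(ℂ)` for every simple polarised complex abelian surface.** [cite: MoonenZarhin1999LowDim, §2 (p0005 L20–L22) and §3 (p0008 L107–L111)]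
[cite: Gordon1999HodgeAVSurvey, Def. 2.14 and Thm. 7.5 (2)] -/
theorem IsSimple.hodgeGroupC_eq_lefschetzIdentityC_of_finrank_eq_two (hX : IsSimple Ψ) (hη : IsRiemannForm Ψ η)
    (hG : G.map (Rat.cast : ℚ → ℝ) = latticeGram Ψ η) (h2 : finrank ℂ E = 2) :
    hodgeGroupC Ψ = lefschetzIdentityC Ψ G :=
  hη.hodgeGroupC_eq_lefschetzIdentityC_of_hodgeGroup_eq_lefschetzIdentity hG
    (hX.hodgeGroup_eq_lefschetzIdentity_of_finrank_eq_two hη hG h2)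

/-- **MOONEN–ZARHIN, CONDITION (D) FOR EVERY SIMPLE ABELIAN SURFACE: `ℬ•(Xⁿ) = 𝒟•(Xⁿ)` for every `n`** — every simple
polarised complex abelian surface is STABLY NONDEGENERATE (Gordon's Thm. 7.5 with `Hg = Lf`, §1, and «type III does not occur
for `g ≤ 3`»). [cite: MoonenZarhin1999LowDim, §2 (p0005 L20–L22: «it follows that `ℬ•(Xⁿ) = 𝒟•(Xⁿ)` for all `n`»), §1 (D) (p0004 L61–L66) and §3 (p0008 L107–L111)]
[cite: Gordon1999HodgeAVSurvey, Thm. 7.5 (1) ⟺ (2)] [cite: HulekLaface2019PicardNumbersAV, §5.1 Prop. 5.1] -/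
theorem IsSimple.forall_divisorClasses_powPeriod_eq_hodgeClasses_of_finrank_eq_two (hX : IsSimple Ψ)
    (hη : IsRiemannForm Ψ η) (h2 : finrank ℂ E = 2) :
    ∀ k p : ℕ, divisorClasses (powPeriod Ψ k) p = hodgeClasses (powPeriod Ψ k) p := by
  obtain ⟨G, hG⟩ := hη.exists_ratMatrix_latticeGram
  exact (hX.forall_divisorClasses_powPeriod_eq_hodgeClasses_iff_hodgeGroup_eq_lefschetzIdentity_of_finrank_eq_two hη hG h2).2
    (hX.hodgeGroup_eq_lefschetzIdentity_of_finrank_eq_two hη hG h2)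

/-- **`Lf(X)(ℂ) = S(X)(ℂ)`: Milne's `S(X)` is connected for every simple abelian surface** («Connected: Yes» for types I, II,
IV; type III does not occur). [cite: Milne1999LefschetzClasses, §2 Summary table (p. 652) and §4 Remark 4.9] [cite: MoonenZarhin1999LowDim, §2 (p0005 L20–L22)] -/
theorem IsSimple.lefschetzIdentityC_eq_lefschetzGroupC_of_finrank_eq_two (hX : IsSimple Ψ) (hη : IsRiemannForm Ψ η)
    (hG : G.map (Rat.cast : ℚ → ℝ) = latticeGram Ψ η) (h2 : finrank ℂ E = 2) :
    lefschetzIdentityC Ψ G = lefschetzGroupC Ψ G :=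
  ((hη.forall_divisorClasses_powPeriod_eq_hodgeClasses_iff_eq_and_hodgeGroupC_eq_lefschetzIdentityC hG (by omega)).1
    (hX.forall_divisorClasses_powPeriod_eq_hodgeClasses_of_finrank_eq_two hη h2)).1

/-- **`Hg(X)(ℂ) = S(X)(ℂ) = Sp_D(V,φ)(ℂ)`** (the full centraliser of `D = End⁰(X)` in `Sp`) for every simple abelian surface.
[cite: MoonenZarhin1999LowDim, §2 (p0005 L20–L22: «`Hg(X) = Sp_D(V,φ)`») and §1 (p0001 L99–L100)] [cite: Milne1999LefschetzClasses, §1 (p. 644) and §2 Summary table] -/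
theorem IsSimple.hodgeGroupC_eq_lefschetzGroupC_of_finrank_eq_two (hX : IsSimple Ψ) (hη : IsRiemannForm Ψ η)
    (hG : G.map (Rat.cast : ℚ → ℝ) = latticeGram Ψ η) (h2 : finrank ℂ E = 2) :
    hodgeGroupC Ψ = lefschetzGroupC Ψ G :=
  (hX.hodgeGroupC_eq_lefschetzIdentityC_of_finrank_eq_two hη hG h2).trans
    (hX.lefschetzIdentityC_eq_lefschetzGroupC_of_finrank_eq_two hη hG h2)

/-- **Real points: `Hg(X)(ℝ) = S(X)(ℝ) = lefschetzGroup Ψ η`** (Milne's centraliser `Sp_D(V,φ)(ℝ)`) for every simple abelian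
surface. [cite: MoonenZarhin1999LowDim, §2 (p0005 L20–L22) and §3 (p0008 L107–L111)] [cite: Milne1999LefschetzClasses, §4 Prop. 4.8 (a) ⟺ (c)] -/
theorem IsSimple.hodgeGroup_eq_lefschetzGroup_of_finrank_eq_two (hX : IsSimple Ψ) (hη : IsRiemannForm Ψ η)
    (h2 : finrank ℂ E = 2) : hodgeGroup Ψ = lefschetzGroup Ψ η := by
  obtain ⟨G, hG⟩ := hη.exists_ratMatrix_latticeGram
  exact ((hη.forall_divisorClasses_powPeriod_eq_hodgeClasses_iff_eq_and_hodgeGroup_eq_lefschetzGroup hG (by omega)).1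
    (hX.forall_divisorClasses_powPeriod_eq_hodgeClasses_of_finrank_eq_two hη h2)).2

end Simple

/-! ## §2 Every polarised abelian surface: `ℬ•(Xⁿ) = 𝒟•(Xⁿ)`, `S(X)` connected, `Hg(X) = Lf(X) = S(X) = Sp_D(V,φ)` -/

section All

variable {κ : Type} [Fintype κ] [DecidableEq κ] [Nonempty κ] {E : Type} [NormedAddCommGroup E] [NormedSpace ℂ E]
  [FiniteDimensional ℂ E] {Ψ : (κ → ℝ) ≃L[ℝ] E} {η : E [⋀^Fin 2]→L[ℝ] ℝ} {G : Matrix κ κ ℚ}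

/-- **MOONEN–ZARHIN §3 AT `g = 2`: EVERY POLARISED COMPLEX ABELIAN SURFACE IS STABLY NONDEGENERATE — `ℬᵖ(Xᵏ) = 𝒟ᵖ(Xᵏ)` for
all `k, p`** (on every power `Xᵏ = Eᵏ/Ψᵏ(ℤ^{κ×k})` and in every codimension `p`, the Hodge classes are the products of divisor
classes; in particular the Hodge conjecture holds for every power of every abelian surface).  Simple: §1; non-simple:
`X ∼ E_{τ₁} × E_{τ₂}` (g48-#3). [cite: MoonenZarhin1999LowDim, §3 (p0008 L107–L111: «for every complex abelian variety `X` of dimension `≤ 3` we have `Hg(X) = Sp_D(V,φ)` and condition (D) … is satisfied»), §1 (D) (p0004 L61–L66) and Introduction (p0001 L62–L64)]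
[cite: Gordon1999HodgeAVSurvey, Thm. 7.5] [cite: vanGeemen1994HodgeAV, §4 Thm. 4.3 (Tate: products of elliptic curves)] -/
theorem IsRiemannForm.divisorClasses_powPeriod_eq_hodgeClasses_of_finrank_eq_two (hη : IsRiemannForm Ψ η)
    (h2 : finrank ℂ E = 2) (k p : ℕ) : divisorClasses (powPeriod Ψ k) p = hodgeClasses (powPeriod Ψ k) p := by
  by_cases hX : IsSimple Ψ
  · exact hX.forall_divisorClasses_powPeriod_eq_hodgeClasses_of_finrank_eq_two hη h2 k p
  · exact hη.forall_divisorClasses_powPeriod_eq_hodgeClasses_of_not_isSimple_of_finrank_eq_two h2 hX k p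

/-- **EVERY COMPLEX ABELIAN SURFACE IS STABLY NONDEGENERATE** (`IsAbelianVariety` form): `ℬ•(Xⁿ) = 𝒟•(Xⁿ)` for every `n`.
[cite: MoonenZarhin1999LowDim, §3 (p0008 L107–L111) and §1 (D) (p0004 L61–L66: «If this condition is satisfied then the Hodge conjecture is "trivially" true for all `Xⁿ`»)]
[cite: Gordon1999HodgeAVSurvey, Thm. 7.5] -/
theorem IsAbelianVariety.forall_divisorClasses_powPeriod_eq_hodgeClasses_of_finrank_eq_two (hA : IsAbelianVariety Ψ)
    (h2 : finrank ℂ E = 2) : ∀ k p : ℕ, divisorClasses (powPeriod Ψ k) p = hodgeClasses (powPeriod Ψ k) p := by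
  obtain ⟨η, hη⟩ := hA
  exact hη.divisorClasses_powPeriod_eq_hodgeClasses_of_finrank_eq_two h2

/-- **`Lf(X)(ℂ) = S(X)(ℂ)`: MILNE'S `S(X)` IS CONNECTED FOR EVERY POLARISED ABELIAN SURFACE** («`X` has no factors of type
III» at `g = 2`; from stable nondegeneracy by Gordon's Thm. 7.5 (1) ⟹ (2)). [cite: Milne1999LefschetzClasses, §2 Summary table (p. 652) and §4 Prop. 4.8, Remark 4.9]
[cite: MoonenZarhin1999LowDim, §1 (p0004 L74–L87: Hazama–Murty) and §2 (p0005 L20–L22)] [cite: Gordon1999HodgeAVSurvey, Thm. 7.5 (1) ⟹ (2)] -/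
theorem IsRiemannForm.lefschetzIdentityC_eq_lefschetzGroupC_of_finrank_eq_two (hη : IsRiemannForm Ψ η)
    (hG : G.map (Rat.cast : ℚ → ℝ) = latticeGram Ψ η) (h2 : finrank ℂ E = 2) :
    lefschetzIdentityC Ψ G = lefschetzGroupC Ψ G :=
  ((hη.forall_divisorClasses_powPeriod_eq_hodgeClasses_iff_eq_and_hodgeGroupC_eq_lefschetzIdentityC hG (by omega)).1
    (hη.divisorClasses_powPeriod_eq_hodgeClasses_of_finrank_eq_two h2)).1

/-- **`Hg(X)(ℂ) = Lf(X)(ℂ)` for every polarised abelian surface** (primed: the unprimed name is g47-#10's Type I(2) statement).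
[cite: MoonenZarhin1999LowDim, §3 (p0008 L107–L111)] [cite: Gordon1999HodgeAVSurvey, Def. 2.14 and Thm. 7.5 (2)] -/
theorem IsRiemannForm.hodgeGroupC_eq_lefschetzIdentityC_of_finrank_eq_two' (hη : IsRiemannForm Ψ η)
    (hG : G.map (Rat.cast : ℚ → ℝ) = latticeGram Ψ η) (h2 : finrank ℂ E = 2) : hodgeGroupC Ψ = lefschetzIdentityC Ψ G :=
  ((hη.forall_divisorClasses_powPeriod_eq_hodgeClasses_iff_eq_and_hodgeGroupC_eq_lefschetzIdentityC hG (by omega)).1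
    (hη.divisorClasses_powPeriod_eq_hodgeClasses_of_finrank_eq_two h2)).2

/-- **«`Hg(X) = Sp_D(V,φ)`» FOR EVERY POLARISED ABELIAN SURFACE, complex points: `Hg(X)(ℂ) = S(X)(ℂ)`** (the full centraliser of
`D = End⁰(X)` in the symplectic group of the polarisation). [cite: MoonenZarhin1999LowDim, §3 (p0008 L107–L111: «for every complex abelian variety `X` of dimension `≤ 3` we have `Hg(X) = Sp_D(V,φ)`») and §1 (p0001 L99–L100)]
[cite: Milne1999LefschetzClasses, §1 (p. 644: «`S(A)` is the largest algebraic subgroup of `Sp(e_D)` whose elements commute with the endomorphisms of `A`»)] -/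
theorem IsRiemannForm.hodgeGroupC_eq_lefschetzGroupC_of_finrank_eq_two (hη : IsRiemannForm Ψ η)
    (hG : G.map (Rat.cast : ℚ → ℝ) = latticeGram Ψ η) (h2 : finrank ℂ E = 2) : hodgeGroupC Ψ = lefschetzGroupC Ψ G :=
  (hη.hodgeGroupC_eq_lefschetzIdentityC_of_finrank_eq_two' hG h2).trans
    (hη.lefschetzIdentityC_eq_lefschetzGroupC_of_finrank_eq_two hG h2)

/-- **«`Hg(X) = Sp_D(V,φ)`» FOR EVERY POLARISED ABELIAN SURFACE, real points: `Hg(X)(ℝ) = S(X)(ℝ) = lefschetzGroup Ψ η`**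
(Milne's centraliser of `End⁰(X)` in `Sp(H₁(X,ℝ), E)`). [cite: MoonenZarhin1999LowDim, §3 (p0008 L107–L111) and §2 (p0005 L20–L22)]
[cite: Milne1999LefschetzClasses, §4 Prop. 4.8 (a) ⟺ (c)] [cite: Gordon1999HodgeAVSurvey, Thm. 7.5] -/
theorem IsRiemannForm.hodgeGroup_eq_lefschetzGroup_of_finrank_eq_two (hη : IsRiemannForm Ψ η) (h2 : finrank ℂ E = 2) :
    hodgeGroup Ψ = lefschetzGroup Ψ η := by
  obtain ⟨G, hG⟩ := hη.exists_ratMatrix_latticeGram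
  exact ((hη.forall_divisorClasses_powPeriod_eq_hodgeClasses_iff_eq_and_hodgeGroup_eq_lefschetzGroup hG (by omega)).1
    (hη.divisorClasses_powPeriod_eq_hodgeClasses_of_finrank_eq_two h2)).2

/-- **`Hg(X)(ℝ) = Lf(X)(ℝ)` for every polarised abelian surface** (primed: the unprimed name is g47-#10's Type I(2) statement).
[cite: MoonenZarhin1999LowDim, §3 (p0008 L107–L111)] [cite: Lange2023AbelianVarietiesComplex, §7.2.4 Exercise (4)(b)] [cite: Gordon1999HodgeAVSurvey, Thm. 7.5 (2)] -/
theorem IsRiemannForm.hodgeGroup_eq_lefschetzIdentity_of_finrank_eq_two' (hη : IsRiemannForm Ψ η)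
    (hG : G.map (Rat.cast : ℚ → ℝ) = latticeGram Ψ η) (h2 : finrank ℂ E = 2) : hodgeGroup Ψ = lefschetzIdentity Ψ G :=
  hodgeGroup_eq_lefschetzIdentity_of_hodgeGroupC_eq_lefschetzIdentityC
    (hη.hodgeGroupC_eq_lefschetzIdentityC_of_finrank_eq_two' hG h2)

/-- **Real points: `Lf(X)(ℝ) = S(X)(ℝ)` for every polarised abelian surface** (all real points of Milne's `S(X)` lie in the
identity component). [cite: Milne1999LefschetzClasses, §2 Summary table (p. 652) and §4 Prop. 4.8] [cite: Lange2023AbelianVarietiesComplex, §7.2.4 Exercise (4)] -/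
theorem IsRiemannForm.lefschetzIdentity_eq_lefschetzGroup_of_finrank_eq_two (hη : IsRiemannForm Ψ η)
    (hG : G.map (Rat.cast : ℚ → ℝ) = latticeGram Ψ η) (h2 : finrank ℂ E = 2) :
    lefschetzIdentity Ψ G = lefschetzGroup Ψ η :=
  hη.lefschetzIdentity_eq_lefschetzGroup_of_hodgeGroup_eq_lefschetzGroup hG
    (hη.hodgeGroup_eq_lefschetzGroup_of_finrank_eq_two h2)

end All

end ComplexTorus

end Literature.Geometry.Kaehler
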